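import Mathlib
import HarnessLib
import Summits.HubbardSuperconductivity.HubbardSuperconductivity.Theorems.KLProgrammeKLRegimeVolumeLimitCouplingExpansion

/-!
# Child `KLRegimeVolumeLimit` (stmt-HubbardSuperconductivity-19665 / its gen-3 twin) — the ORDER-`U²` RUNG of the volume-limit
# carrier, structural form: the second `U`-derivative of `klSelfEnergy … (nScales β + 1)` at `U = 0` is the second cumulant
# (seat hubbard-kl-k3c5-p3; sequel of `…VolumeLimitCouplingExpansion` (first derivative, seat k3c5-p2))

By the frame reduction (`…VolumeLimitFrameReduction`) the carrier of the VL text is, near `U = 0`, the rational function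
`Σ̂^K(k,σ;U) = (N(U)/D(U) + βL² ĝ_K(k))/(βL² ĝ_K(k)²)` of the two BARE Gaussian integrals `N(U) = ∫dμ_C ψ̂⁺_{kσ}ψ̂⁻_{kσ} e^{−V(U)}`,
`D(U) = ∫dμ_C e^{−V(U)}`, `V(U) = U·W`.  `§1` differentiates the Boltzmann-weighted Gaussian integral at EVERY coupling:

  `d/dU ∫dμ_C F e^{−V(U)} = −∫dμ_C F·W·e^{−V(U)}`     (`hasDerivAt_gaussExpect_mul_grassmannExp_neg_at`),

so `N'' (0) = ∫ ψ̂⁺ψ̂⁻ W²`, `D''(0) = ∫ W²`; `§2` differentiates the ratio twice: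

  `d²/dU²|₀ Σ̂^K(k,σ;U) = (N₂ − N₀ D₂ − 2 D₁ (N₁ − N₀ D₁)) / (βL² ĝ_K(k)²)`,
  `N_j = ∫dμ_C ψ̂⁺_{kσ}ψ̂⁻_{kσ} Wʲ`, `D_j = ∫dμ_C Wʲ` (`D₀ = 1`)

— the truncated (connected) second-order insertion `⟨ψ̂⁺ψ̂⁻; W; W⟩`, re-amputated with the frame propagator
(`hasDerivAt_deriv_klSelfEnergy_nScales_succ_zero`).  Its Wick evaluation (sunset + tadpole-insertion + reducible double tadpole)
and the VL-shaped volume limit of the resulting `U²`-coefficient are the sequels.  Everything is proved; no definition.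
-/

noncomputable section

namespace Summit.HubbardSuperconductivity.HubbardSuperconductivity.Theorems.TwoPointAssembly

set_option linter.dupNamespace false -- summit = problem name (single-conjunct summit), D-0017

open Finset Filter Topology Literature.MathematicalPhysics.QuantumLattice Literature.Probability.LatticeModels GrassmannAlgebra
open Summit.HubbardSuperconductivity.HubbardSuperconductivity.Theorems.KLRegimeSplit
open Summit.HubbardSuperconductivity.HubbardSuperconductivity.Theorems.KLProgrammeLegKernels

variable {L M : ℕ} [NeZero L]

/-! ## §1 The Boltzmann-weighted Gaussian integral is differentiable at every coupling -/

/-- Termwise derivative of the shifted coupling polynomial: `d/dU Σ_{j ≤ J} ((−U)ʲ/j!) c_j = −Σ_{j < J} ((−U)ʲ/j!) c_{j+1}`. -/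
theorem hasDerivAt_couplingPoly_at (c : ℕ → ℂ) (J : ℕ) (U : ℝ) :
    HasDerivAt (fun U : ℝ => ∑ j ∈ range (J + 1), (((-U) ^ j / j.factorial : ℝ) : ℂ) * c j)
      (-∑ j ∈ range J, (((-U) ^ j / j.factorial : ℝ) : ℂ) * c (j + 1)) U := by
  -- the `j + 1` term
  have hterm : ∀ j : ℕ, HasDerivAt (fun U : ℝ => (((-U) ^ (j + 1) / (j + 1).factorial : ℝ) : ℂ) * c (j + 1))
      (-((((-U) ^ j / j.factorial : ℝ) : ℂ) * c (j + 1))) U := by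
    intro j
    have h1 : HasDerivAt (fun U : ℝ => (-U) ^ (j + 1) / ((j + 1).factorial : ℝ))
        (((j + 1 : ℕ) : ℝ) * (-U) ^ (j + 1 - 1) * (-1) / (j + 1).factorial) U :=
      ((hasDerivAt_neg U).pow (j + 1)).div_const _
    have h2 := (h1.ofReal_comp).mul_const (c (j + 1))
    refine h2.congr_deriv ?_
    have hfac : (((j + 1).factorial : ℕ) : ℝ) = ((j + 1 : ℕ) : ℝ) * (j.factorial : ℝ) := by
      rw [Nat.factorial_succ]; push_cast; ring
    have hj : ((j + 1 : ℕ) : ℝ) ≠ 0 := by positivity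
    have hjf : (j.factorial : ℝ) ≠ 0 := by positivity
    rw [Nat.add_sub_cancel, neg_mul_eq_neg_mul]
    congr 1
    rw [hfac]
    push_cast
    field_simp
  -- the `j = 0` term is constant
  have h0 : HasDerivAt (fun _ : ℝ => (((-(0 : ℝ)) ^ 0 / (0 : ℕ).factorial : ℝ) : ℂ) * c 0) 0 U := hasDerivAt_const U _
  have hsum := (HasDerivAt.fun_sum (u := range J) fun j _ => hterm j).add h0
  have hfun : (fun U : ℝ => ∑ j ∈ range (J + 1), (((-U) ^ j / j.factorial : ℝ) : ℂ) * c j) =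
      fun U : ℝ => (∑ j ∈ range J, (((-U) ^ (j + 1) / (j + 1).factorial : ℝ) : ℂ) * c (j + 1)) +
        (((-(0 : ℝ)) ^ 0 / (0 : ℕ).factorial : ℝ) : ℂ) * c 0 := by
    funext U
    rw [Finset.sum_range_succ']
    simp
  rw [hfun]
  refine hsum.congr_deriv ?_
  rw [add_zero, Finset.sum_neg_distrib]

/-- **`d/dU ∫dμ_C F e^{−V(U)} = −∫dμ_C F·W·e^{−V(U)}` at EVERY coupling `U`** (any `F`, any covariance; `W = V(1)`). -/
theorem hasDerivAt_gaussExpect_mul_grassmannExp_neg_at (C : Matrix (HubbardFieldIdx L M) (HubbardFieldIdx L M) ℂ)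
    (F : HubbardGrassmann L M) (β U : ℝ) :
    HasDerivAt (fun U : ℝ => gaussExpect ℂ C (F * grassmannExp (-(hubbardInteraction L M β U))))
      (-gaussExpect ℂ C (F * hubbardInteraction L M β 1 * grassmannExp (-(hubbardInteraction L M β U)))) U := by
  obtain ⟨J, -, hJ⟩ := exists_hubbardInteraction_one_pow_eq_zero (L := L) (M := M) β
  have hJ1 : hubbardInteraction L M β 1 ^ (J + 1) = 0 := by rw [pow_succ, hJ, zero_mul]
  have h := hasDerivAt_couplingPoly_at (fun j => gaussExpect ℂ C (F * hubbardInteraction L M β 1 ^ j)) J U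
  have hfun : (fun U : ℝ => gaussExpect ℂ C (F * grassmannExp (-(hubbardInteraction L M β U)))) =
      fun U : ℝ => ∑ j ∈ range (J + 1), (((-U) ^ j / j.factorial : ℝ) : ℂ) *
        gaussExpect ℂ C (F * hubbardInteraction L M β 1 ^ j) := by
    funext U
    exact gaussExpect_mul_grassmannExp_neg_eq_sum C F β U hJ1
  rw [hfun]
  refine h.congr_deriv ?_
  rw [gaussExpect_mul_grassmannExp_neg_eq_sum C (F * hubbardInteraction L M β 1) β U hJ]
  congr 1
  refine Finset.sum_congr rfl fun j _ => ?_
  rw [mul_assoc, ← pow_succ']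

/-- `d/dU D(U) = −∫dμ_C W e^{−V(U)}` at every coupling. -/
theorem hasDerivAt_effPartitionFn_at (C : Matrix (HubbardFieldIdx L M) (HubbardFieldIdx L M) ℂ) (β U : ℝ) :
    HasDerivAt (fun U : ℝ => effPartitionFn ℂ C (hubbardInteraction L M β U))
      (-gaussExpect ℂ C (hubbardInteraction L M β 1 * grassmannExp (-(hubbardInteraction L M β U)))) U := by
  have h := hasDerivAt_gaussExpect_mul_grassmannExp_neg_at C 1 β U
  simp only [one_mul] at h
  have hfun : (fun U : ℝ => effPartitionFn ℂ C (hubbardInteraction L M β U)) =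
      fun U : ℝ => gaussExpect ℂ C (grassmannExp (-(hubbardInteraction L M β U))) := by
    funext U; rw [effPartitionFn_eq_gaussExpect]
  rw [hfun]
  exact h

/-! ## §2 The second `U`-derivative of the two-leg kernel at `U = 0` -/

/-- **`d²/dU²|₀ Σ̂^K(k,σ;U) = (N₂ − N₀D₂ − 2D₁(N₁ − N₀D₁))/(βL² ĝ_K(k)²)`** (`β ≠ 0`; `C` = bare covariance, `W = V(1)`,
`N_j = ∫dμ_C ψ̂⁺_{kσ}ψ̂⁻_{kσ}Wʲ`, `D_j = ∫dμ_C Wʲ`): the derivative of `U ↦ Σ̂^K` exists near `0` and is itself differentiable at `0`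
with this value — the truncated second-order insertion, re-amputated with the frame propagator. -/
theorem hasDerivAt_deriv_selfEnergy_fullActionCT_zero {β : ℝ} (hβ : β ≠ 0) (μ : ℝ) (K : TrigPolyC4v) (k : FreqMomentum L M)
    (σ : Fin 2) :
    HasDerivAt (deriv fun U : ℝ => selfEnergy L M β (fullActionCT L M β U μ K) k σ)
      ((gaussExpect ℂ (hubbardCovariance L M β μ 0)
            (gen ℂ (((k, σ), 0) : HubbardFieldIdx L M) * gen ℂ (((k, σ), 1) : HubbardFieldIdx L M) *
              hubbardInteraction L M β 1 ^ 2) -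
          gaussExpect ℂ (hubbardCovariance L M β μ 0)
              (gen ℂ (((k, σ), 0) : HubbardFieldIdx L M) * gen ℂ (((k, σ), 1) : HubbardFieldIdx L M)) *
            gaussExpect ℂ (hubbardCovariance L M β μ 0) (hubbardInteraction L M β 1 ^ 2) -
          2 * gaussExpect ℂ (hubbardCovariance L M β μ 0) (hubbardInteraction L M β 1) *
            (gaussExpect ℂ (hubbardCovariance L M β μ 0)
                (gen ℂ (((k, σ), 0) : HubbardFieldIdx L M) * gen ℂ (((k, σ), 1) : HubbardFieldIdx L M) *
                  hubbardInteraction L M β 1) -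
              gaussExpect ℂ (hubbardCovariance L M β μ 0)
                  (gen ℂ (((k, σ), 0) : HubbardFieldIdx L M) * gen ℂ (((k, σ), 1) : HubbardFieldIdx L M)) *
                gaussExpect ℂ (hubbardCovariance L M β μ 0) (hubbardInteraction L M β 1))) /
        (((β * (L : ℝ) ^ 2 : ℝ) : ℂ) * propCT L M β μ K k ^ 2)) 0 := by
  have hβL : ((β * (L : ℝ) ^ 2 : ℝ) : ℂ) ≠ 0 := by
    have hL : (L : ℝ) ≠ 0 := by exact_mod_cast NeZero.ne L
    exact_mod_cast mul_ne_zero hβ (pow_ne_zero 2 hL)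
  have hg := propCT_ne_zero (L := L) hβ μ K k
  set C := hubbardCovariance L M β μ 0 with hC
  set W : HubbardGrassmann L M := hubbardInteraction L M β 1 with hW
  set ab : HubbardGrassmann L M := gen ℂ (((k, σ), 0) : HubbardFieldIdx L M) * gen ℂ (((k, σ), 1) : HubbardFieldIdx L M)
    with hab
  set cg : ℂ := ((β * (L : ℝ) ^ 2 : ℝ) : ℂ) * propCT L M β μ K k with hcg
  set cg2 : ℂ := ((β * (L : ℝ) ^ 2 : ℝ) : ℂ) * propCT L M β μ K k ^ 2 with hcg2
  have hcg2ne : cg2 ≠ 0 := mul_ne_zero hβL (pow_ne_zero 2 hg)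
  -- the polynomials `N`, `D` and their first two derivatives
  set N : ℝ → ℂ := fun U => gaussExpect ℂ C (ab * grassmannExp (-(hubbardInteraction L M β U))) with hN
  set D : ℝ → ℂ := fun U => effPartitionFn ℂ C (hubbardInteraction L M β U) with hD
  set N' : ℝ → ℂ := fun U => -gaussExpect ℂ C (ab * W * grassmannExp (-(hubbardInteraction L M β U))) with hN'
  set D' : ℝ → ℂ := fun U => -gaussExpect ℂ C (W * grassmannExp (-(hubbardInteraction L M β U))) with hD'
  have hNd : ∀ U, HasDerivAt N (N' U) U := fun U => hasDerivAt_gaussExpect_mul_grassmannExp_neg_at C ab β U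
  have hDd : ∀ U, HasDerivAt D (D' U) U := fun U => hasDerivAt_effPartitionFn_at C β U
  have hN'd : ∀ U, HasDerivAt N' (gaussExpect ℂ C (ab * W * W * grassmannExp (-(hubbardInteraction L M β U)))) U := by
    intro U
    have h := (hasDerivAt_gaussExpect_mul_grassmannExp_neg_at C (ab * W) β U).neg
    simp only [neg_neg] at h
    exact h
  have hD'd : ∀ U, HasDerivAt D' (gaussExpect ℂ C (W * W * grassmannExp (-(hubbardInteraction L M β U)))) U := by
    intro U
    have h := (hasDerivAt_gaussExpect_mul_grassmannExp_neg_at C W β U).neg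
    simp only [neg_neg] at h
    exact h
  -- values at `U = 0`
  have hexp0 : grassmannExp (-(hubbardInteraction L M β 0)) = 1 := by
    rw [hubbardInteraction_zero_coupling, neg_zero, grassmannExp, IsNilpotent.exp_zero]
  have hD0 : D 0 = 1 := effPartitionFn_hubbardInteraction_zero C β
  have hN0 : N 0 = gaussExpect ℂ C ab := by simp only [hN, hexp0, mul_one]
  have hN'0 : N' 0 = -gaussExpect ℂ C (ab * W) := by simp only [hN', hexp0, mul_one]
  have hD'0 : D' 0 = -gaussExpect ℂ C W := by simp only [hD', hexp0, mul_one]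
  have hN''0 : gaussExpect ℂ C (ab * W * W * grassmannExp (-(hubbardInteraction L M β 0))) = gaussExpect ℂ C (ab * W ^ 2) := by
    rw [hexp0, mul_one, mul_assoc, ← pow_two]
  have hD''0 : gaussExpect ℂ C (W * W * grassmannExp (-(hubbardInteraction L M β 0))) = gaussExpect ℂ C (W ^ 2) := by
    rw [hexp0, mul_one, ← pow_two]
  -- `D ≠ 0` near `0`
  have hDne : ∀ᶠ U : ℝ in 𝓝 0, D U ≠ 0 := by
    have hc : ContinuousAt D 0 := (hDd 0).continuousAt
    have : D 0 ≠ 0 := by rw [hD0]; exact one_ne_zero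
    exact hc.eventually_ne this
  -- the derivative near `0` is the quotient-rule expression
  set q : ℝ → ℂ := fun U => ((N' U * D U - N U * D' U) / D U ^ 2) / cg2 with hq
  have hderiv : deriv (fun U : ℝ => selfEnergy L M β (fullActionCT L M β U μ K) k σ) =ᶠ[𝓝 0] q := by
    -- `D ≠ 0` on an open neighbourhood: there the function IS the ratio, so its derivative is `q`
    have hopen : ∀ᶠ U : ℝ in 𝓝 0, ∀ᶠ U' : ℝ in 𝓝 U, D U' ≠ 0 := by
      have hc : Continuous D := continuous_iff_continuousAt.2 fun U => (hDd U).continuousAt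
      have ho : IsOpen {U : ℝ | D U ≠ 0} := isOpen_ne_fun hc continuous_const
      have hmem : {U : ℝ | D U ≠ 0} ∈ 𝓝 (0 : ℝ) := ho.mem_nhds (by show D 0 ≠ 0; rw [hD0]; exact one_ne_zero)
      filter_upwards [hmem] with U hU
      exact ho.mem_nhds hU
    filter_upwards [hDne, hopen] with U hU hU'
    have hratio : (fun U' : ℝ => selfEnergy L M β (fullActionCT L M β U' μ K) k σ) =ᶠ[𝓝 U]
        fun U' : ℝ => (N U' / D U' + cg) / cg2 := by
      filter_upwards [hU'] with U' hU''
      exact selfEnergy_fullActionCT_eq_bare_ratio hβ U' μ K k σ hU''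
    have hq' : HasDerivAt (fun U' : ℝ => (N U' / D U' + cg) / cg2) (q U) U := by
      have h := (((hNd U).div (hDd U) hU).add_const cg).div_const cg2
      refine h.congr_deriv ?_
      simp only [hq]
    exact (hq'.congr_of_eventuallyEq hratio).deriv
  -- differentiate `q` at `0`
  have hqd : HasDerivAt q
      (((gaussExpect ℂ C (ab * W ^ 2) * D 0 + N' 0 * D' 0 - (N' 0 * D' 0 + N 0 * gaussExpect ℂ C (W ^ 2))) * D 0 ^ 2 -
          (N' 0 * D 0 - N 0 * D' 0) * ((2 : ℕ) * D 0 ^ (2 - 1) * D' 0)) / (D 0 ^ 2) ^ 2 / cg2) 0 := by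
    have hnum := ((hN'd 0).fun_mul (hDd 0)).fun_sub ((hNd 0).fun_mul (hD'd 0))
    rw [hN''0, hD''0] at hnum
    have hden := (hDd 0).fun_pow 2
    have h := (hnum.fun_div hden (by simp only [hD0]; norm_num)).div_const cg2
    exact h
  refine (hqd.congr_of_eventuallyEq hderiv).congr_deriv ?_
  rw [hD0, hN0, hN'0, hD'0]
  simp only [one_pow, mul_one, Nat.cast_ofNat, div_one]
  ring

/-- **The ORDER-`U²` RUNG of the VL carrier, structural form**: for `β > 0` the derivative of the carrier
`U ↦ klSelfEnergy L M β U μ K klE0 (nScales β + 1) k σ` is differentiable at `U = 0`, with second derivative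
`(N₂ − N₀D₂ − 2D₁(N₁ − N₀D₁))/(βL² ĝ_K(k)²)` — the truncated second-order insertion `⟨ψ̂⁺_{kσ}ψ̂⁻_{kσ}; W; W⟩₀` re-amputated with
the frame propagator (`N_j = ∫dμ_C ψ̂⁺_{kσ}ψ̂⁻_{kσ}Wʲ`, `D_j = ∫dμ_C Wʲ`, `C` the bare covariance, `W = V(1)`). -/
theorem hasDerivAt_deriv_klSelfEnergy_nScales_succ_zero {β : ℝ} (hβ : 0 < β) (μ : ℝ) (K : TrigPolyC4v) (k : FreqMomentum L M)
    (σ : Fin 2) :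
    HasDerivAt (deriv fun U : ℝ => klSelfEnergy L M β U μ K klE0 (nScales β + 1) k σ)
      ((gaussExpect ℂ (hubbardCovariance L M β μ 0)
            (gen ℂ (((k, σ), 0) : HubbardFieldIdx L M) * gen ℂ (((k, σ), 1) : HubbardFieldIdx L M) *
              hubbardInteraction L M β 1 ^ 2) -
          gaussExpect ℂ (hubbardCovariance L M β μ 0)
              (gen ℂ (((k, σ), 0) : HubbardFieldIdx L M) * gen ℂ (((k, σ), 1) : HubbardFieldIdx L M)) *
            gaussExpect ℂ (hubbardCovariance L M β μ 0) (hubbardInteraction L M β 1 ^ 2) -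
          2 * gaussExpect ℂ (hubbardCovariance L M β μ 0) (hubbardInteraction L M β 1) *
            (gaussExpect ℂ (hubbardCovariance L M β μ 0)
                (gen ℂ (((k, σ), 0) : HubbardFieldIdx L M) * gen ℂ (((k, σ), 1) : HubbardFieldIdx L M) *
                  hubbardInteraction L M β 1) -
              gaussExpect ℂ (hubbardCovariance L M β μ 0)
                  (gen ℂ (((k, σ), 0) : HubbardFieldIdx L M) * gen ℂ (((k, σ), 1) : HubbardFieldIdx L M)) *
                gaussExpect ℂ (hubbardCovariance L M β μ 0) (hubbardInteraction L M β 1))) /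
        (((β * (L : ℝ) ^ 2 : ℝ) : ℂ) * propCT L M β μ K k ^ 2)) 0 := by
  have hfun : (fun U : ℝ => klSelfEnergy L M β U μ K klE0 (nScales β + 1) k σ) =
      fun U : ℝ => selfEnergy L M β (fullActionCT L M β U μ K) k σ := by
    funext U
    rw [klSelfEnergy, klEffectiveAction_nScales_succ L M hβ, ← fullActionCT]
  rw [hfun]
  exact hasDerivAt_deriv_selfEnergy_fullActionCT_zero hβ.ne' μ K k σ

end Summit.HubbardSuperconductivity.HubbardSuperconductivity.Theorems.TwoPointAssembly

end
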